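import Summits.Ventures.HodgeRepro.RouteCClauses

/-!
# Which printed clause is load-bearing? — every one of the eight, formally: each clause is logically
independent of the other seven over the conclusion «the face's Weil line is algebraic»

Blind re-derivation cell `pub-hodge-repro`, seat `night-1`.  `RouteCClauses.routeC_closes_face` derives
`WeilAlgebraic T` for a corner family `T` from the bundle `Clauses p k` of eight clauses.  This file shows the
bundle is IRREDUNDANT on every face: for each clause `X` there is a vocabulary `V : Vocab G c` in which the other
seven clauses hold at the face's `(p, k)` (and DR / Liu–Shimura / Lemma R / the bookkeeping for all parameters)
while `X` fails and `WeilAlgebraic T` fails.  So no clause can be dropped from the discharge of any face: the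
answer to «which printed clause is load-bearing» is «all eight», and the face-specific content of the report
(`FACES8-TABLE.md`, `FACES12-TABLE.md`) is WHERE each is used — the `(p, n)` of BMM Cor 2 (at the boundary
`n = p/3` for `g = 6`), the rank `n = p + 1` of Liu Cor 4.20, the reflex fields of the Liu types, the coset
`G`-set of Lemma R.

The counter-vocabularies are built from `ℕ` as the type of «varieties» with a few codes (`0` = the ball
quotient, `7` = Liu's `A_μ`, `3` = a simple factor, `card J` = the reduced product of `J` classes) and `Prop`
fields chosen to satisfy exactly the clauses named; nothing geometric is asserted.  Nothing here says anything
about the status of the Hodge conjecture for CM abelian varieties, which is NOT proved.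
-/

open Finset
open scoped Pointwise

namespace HodgeRepro.RouteC

namespace LoadBearing

variable {G : Type} [Group G] [DecidableEq G] {c : G}

/-- The type of characters used by the counter-vocabularies: the CM types themselves. -/
abbrev CMChar (c : G) : Type _ := {Φ : Finset G // IsCMType c Φ}

/-- A counter-vocabulary on `ℕ`: `HC`, `Surj`, `IsBallQuot`, `Isog`, `IsogFactorMult`, `WeilAlgebraic` and the
«reduced product» code are the parameters; `Char` is a parameter with its CM types; everything else is a code. -/
def mk (HC : ℕ → ℕ → Prop) (Surj : ℕ → ℕ → Prop) (IsBallQuot : ℕ → ℕ → Prop)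
    (Char : Type) (cmType : Char → Finset G) (hcm : ∀ μ, IsCMType c (cmType μ))
    (Isog : ℕ → ℕ → Prop) (IsogFM : ℕ → ℕ → ℕ → Prop)
    (Weil : ∀ {ι : Type} [Fintype ι], (ι → Finset G) → Prop)
    (SP : ∀ {J : Type} [Fintype J] [DecidableEq J], (J → Finset G) → ℕ) : Vocab G c where
  Var := ℕ
  HC := HC
  Surj := Surj
  IsBallQuot := IsBallQuot
  Simple _ := 3
  SimpleProd := SP
  Pow _ _ := 5
  Isog := Isog
  IsogFactorMult := IsogFM
  Char := Char
  cmType := cmType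
  isCMType_cmType := hcm
  Aμ _ := 7
  Level := Unit
  X _ _ := 0
  Alb _ := 0
  WeilAlgebraic := Weil

/-- A CM type of `(G, c)` gives a `CMChar`. -/
def toChar {Φ : Finset G} (h : IsCMType c Φ) : CMChar c := ⟨Φ, h⟩

/-! ### The eight independence theorems -/

/-- **BMM Cor 2 is load-bearing**: at every `(p, n)` inside its range there is a vocabulary satisfying the other
seven clauses (for all parameters) in which BMM Cor 2 fails and no Weil line is algebraic. -/
theorem bmm_independent (p n : ℕ) (hn : n ≤ p) (hr : ¬ (p < 3 * n ∧ 3 * n < 2 * p)) :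
    ∃ V : Vocab G c, (∀ k, V.Meng2019_Lemma4_1_codim k) ∧ V.DR2015_Lemma3_5 ∧
      (∀ q, V.Liu2021_Cor4_20 q) ∧ V.Liu2021_Def4_5_Shimura8_3 ∧ (∀ q, V.RouteC_R5 q) ∧
      V.RouteC_LemmaR ∧ V.IsogFactorMult_of_isog_pow ∧ ¬ V.BMM2016_Cor2 p n ∧
      ∀ {ι : Type} [Fintype ι] (T : ι → Finset G), ¬ V.WeilAlgebraic T := by
  refine ⟨mk (fun _ _ => False) (fun _ _ => True) (fun _ _ => True) (CMChar c) (fun μ : CMChar c => μ.1)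
    (fun μ : CMChar c => μ.2) (fun _ _ => True) (fun _ _ _ => True) (fun _ => False) (fun _ => 0),
    ?_, ?_, ?_, ?_, ?_, ?_, ?_, ?_, ?_⟩
  · intro k X Y _ h; exact h.elim
  · intro Φ hΦ; exact ⟨toChar hΦ, rfl⟩
  · intro q _ μ m; exact ⟨(), trivial⟩
  · intro μ; exact ⟨1, le_rfl, trivial⟩
  · intro q _ J _ _ Φ _ _ _; exact ⟨(0 : ℕ), trivial, trivial⟩
  · intro ι J _ _ _ _ Φ cls tw _ _ _ _ h; exact h.elim
  · intro X Y Z d m _ _ h; exact h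
  · intro h; exact h hn hr (0 : ℕ) trivial
  · intro ι _ T h; exact h

/-- **R7 (Meng Lemma 4.1, codimension-wise) is load-bearing**: a vocabulary in which the ball quotient (`0`)
satisfies HC but the reduced product (`1`) does not, although everything maps onto everything. -/
theorem meng_independent (p k : ℕ) :
    ∃ V : Vocab G c, V.BMM2016_Cor2 p k ∧ V.DR2015_Lemma3_5 ∧ (∀ q, V.Liu2021_Cor4_20 q) ∧
      V.Liu2021_Def4_5_Shimura8_3 ∧ (∀ q, V.RouteC_R5 q) ∧ V.RouteC_LemmaR ∧
      V.IsogFactorMult_of_isog_pow ∧ ¬ V.Meng2019_Lemma4_1_codim k ∧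
      ∀ {ι : Type} [Fintype ι] (T : ι → Finset G), ¬ V.WeilAlgebraic T := by
  refine ⟨mk (fun S _ => S = 0) (fun _ _ => True) (fun S _ => S = 0) (CMChar c) (fun μ : CMChar c => μ.1)
    (fun μ : CMChar c => μ.2) (fun _ _ => True) (fun _ _ _ => True) (fun _ => False) (fun _ => 1),
    ?_, ?_, ?_, ?_, ?_, ?_, ?_, ?_, ?_⟩
  · intro _ _ S hS; exact hS
  · intro Φ hΦ; exact ⟨toChar hΦ, rfl⟩
  · intro q _ μ m; exact ⟨(), trivial⟩
  · intro μ; exact ⟨1, le_rfl, trivial⟩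
  · intro q _ J _ _ Φ _ _ _; exact ⟨(0 : ℕ), rfl, trivial⟩
  · intro ι J _ _ _ _ Φ cls tw _ _ _ _ h; exact absurd h one_ne_zero
  · intro X Y Z d m _ _ h; exact h
  · intro h; exact one_ne_zero (h (0 : ℕ) (1 : ℕ) trivial rfl)
  · intro ι _ T h; exact h

/-- **DR Lemma 3.5 is load-bearing**: with NO characters at all, Liu's clauses hold vacuously, the ball
quotient exists for the empty family only, and the face's Weil line is not algebraic.  (Needs one CM type `Φ₀`
to witness the failure of DR.) -/
theorem dr_independent (p k : ℕ) {Φ₀ : Finset G} (hΦ₀ : IsCMType c Φ₀) :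
    ∃ V : Vocab G c, V.BMM2016_Cor2 p k ∧ (∀ j, V.Meng2019_Lemma4_1_codim j) ∧
      (∀ q, V.Liu2021_Cor4_20 q) ∧ V.Liu2021_Def4_5_Shimura8_3 ∧ (∀ q, V.RouteC_R5 q) ∧
      V.RouteC_LemmaR ∧ V.IsogFactorMult_of_isog_pow ∧ ¬ V.DR2015_Lemma3_5 ∧
      ∀ {ι : Type} [Fintype ι] [Nonempty ι] (T : ι → Finset G), ¬ V.WeilAlgebraic T := by
  refine ⟨mk (fun S _ => S = 0) (fun _ Y => Y = 0) (fun S _ => S = 0) PEmpty PEmpty.elim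
    (fun μ => μ.elim) (fun _ _ => True) (fun _ _ _ => False) (fun {ι} _ _ => IsEmpty ι)
    (fun {J} _ _ _ => Fintype.card J),
    ?_, ?_, ?_, ?_, ?_, ?_, ?_, ?_, ?_⟩
  · intro _ _ S hS; exact hS
  · intro j X Y hXY _; exact hXY
  · intro q _ μ; exact μ.elim
  · intro μ; exact μ.elim
  · intro q _ J _ _ Φ _ halb _
    by_cases hJ : Nonempty J
    · obtain ⟨k₀⟩ := hJ
      obtain ⟨_, h⟩ := halb k₀ 0
      exact h.elim
    · refine ⟨(0 : ℕ), rfl, ?_⟩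
      show Fintype.card J = 0
      rw [Fintype.card_eq_zero_iff]; exact not_nonempty_iff.1 hJ
  · intro ι J _ _ _ _ Φ cls tw _ _ _ _ h
    show IsEmpty ι
    have hJ : IsEmpty J := by
      rw [← Fintype.card_eq_zero_iff]; exact h
    exact Function.isEmpty cls
  · intro X Y Z d m _ _ h; exact h.elim
  · intro h; obtain ⟨μ, _⟩ := h Φ₀ hΦ₀; exact μ.elim
  · intro ι _ _ T h; exact h.false (Classical.arbitrary ι)

/-- **Liu Cor 4.20 is load-bearing**: characters exist, but nothing is an Albanese factor. -/
theorem liu_independent (p k : ℕ) (hp : 3 ≤ p + 1) {Φ₀ : Finset G} (hΦ₀ : IsCMType c Φ₀) :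
    ∃ V : Vocab G c, V.BMM2016_Cor2 p k ∧ (∀ j, V.Meng2019_Lemma4_1_codim j) ∧ V.DR2015_Lemma3_5 ∧
      V.Liu2021_Def4_5_Shimura8_3 ∧ (∀ q, V.RouteC_R5 q) ∧ V.RouteC_LemmaR ∧
      V.IsogFactorMult_of_isog_pow ∧ ¬ V.Liu2021_Cor4_20 p ∧
      ∀ {ι : Type} [Fintype ι] [Nonempty ι] (T : ι → Finset G), ¬ V.WeilAlgebraic T := by
  refine ⟨mk (fun S _ => S = 0) (fun _ Y => Y = 0) (fun S _ => S = 0) (CMChar c) (fun μ : CMChar c => μ.1)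
    (fun μ : CMChar c => μ.2) (fun _ _ => True) (fun _ _ _ => False) (fun {ι} _ _ => IsEmpty ι)
    (fun {J} _ _ _ => Fintype.card J),
    ?_, ?_, ?_, ?_, ?_, ?_, ?_, ?_, ?_⟩
  · intro _ _ S hS; exact hS
  · intro j X Y hXY _; exact hXY
  · intro Φ hΦ; exact ⟨toChar hΦ, rfl⟩
  · intro μ; exact ⟨1, le_rfl, trivial⟩
  · intro q _ J _ _ Φ _ halb _
    by_cases hJ : Nonempty J
    · obtain ⟨k₀⟩ := hJ
      obtain ⟨_, h⟩ := halb k₀ 0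
      exact h.elim
    · refine ⟨(0 : ℕ), rfl, ?_⟩
      show Fintype.card J = 0
      rw [Fintype.card_eq_zero_iff]; exact not_nonempty_iff.1 hJ
  · intro ι J _ _ _ _ Φ cls tw _ _ _ _ h
    show IsEmpty ι
    have hJ : IsEmpty J := by
      rw [← Fintype.card_eq_zero_iff]; exact h
    exact Function.isEmpty cls
  · intro X Y Z d m _ _ h; exact h.elim
  · intro h; obtain ⟨_, h'⟩ := h hp (toChar hΦ₀) 0; exact h'
  · intro ι _ _ T h; exact h.false (Classical.arbitrary ι)

/-- **Liu Def 4.5 + Shimura §8.3 is load-bearing**: `A_μ` (`7`) is an Albanese factor, but is isogenous to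
nothing, so no simple factor (`3`) reaches the Albanese. -/
theorem liuShimura_independent (p k : ℕ) {Φ₀ : Finset G} (hΦ₀ : IsCMType c Φ₀) :
    ∃ V : Vocab G c, V.BMM2016_Cor2 p k ∧ (∀ j, V.Meng2019_Lemma4_1_codim j) ∧ V.DR2015_Lemma3_5 ∧
      (∀ q, V.Liu2021_Cor4_20 q) ∧ (∀ q, V.RouteC_R5 q) ∧ V.RouteC_LemmaR ∧
      V.IsogFactorMult_of_isog_pow ∧ ¬ V.Liu2021_Def4_5_Shimura8_3 ∧
      ∀ {ι : Type} [Fintype ι] [Nonempty ι] (T : ι → Finset G), ¬ V.WeilAlgebraic T := by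
  refine ⟨mk (fun S _ => S = 0) (fun _ Y => Y = 0) (fun S _ => S = 0) (CMChar c) (fun μ : CMChar c => μ.1)
    (fun μ : CMChar c => μ.2) (fun _ _ => False) (fun _ Y _ => Y = 7) (fun {ι} _ _ => IsEmpty ι)
    (fun {J} _ _ _ => Fintype.card J),
    ?_, ?_, ?_, ?_, ?_, ?_, ?_, ?_, ?_⟩
  · intro _ _ S hS; exact hS
  · intro j X Y hXY _; exact hXY
  · intro Φ hΦ; exact ⟨toChar hΦ, rfl⟩
  · intro q _ μ m; exact ⟨(), rfl⟩
  · intro q _ J _ _ Φ _ halb _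
    by_cases hJ : Nonempty J
    · obtain ⟨k₀⟩ := hJ
      obtain ⟨_, h⟩ := halb k₀ 0
      exact absurd h (show ¬ ((3 : ℕ) = 7) by norm_num)
    · refine ⟨(0 : ℕ), rfl, ?_⟩
      show Fintype.card J = 0
      rw [Fintype.card_eq_zero_iff]; exact not_nonempty_iff.1 hJ
  · intro ι J _ _ _ _ Φ cls tw _ _ _ _ h
    show IsEmpty ι
    have hJ : IsEmpty J := by
      rw [← Fintype.card_eq_zero_iff]; exact h
    exact Function.isEmpty cls
  · intro X Y Z d m _ h; exact h.elim
  · intro h; obtain ⟨d, _, h'⟩ := h (toChar hΦ₀); exact h'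
  · intro ι _ _ T h; exact h.false (Classical.arbitrary ι)

/-- **R5 (dominance) is load-bearing**: no ball quotients at all; every other clause holds, and the face's
hypotheses (its representatives are CM types with `g ≤ p`) exhibit the failure of R5. -/
theorem r5_independent (p k : ℕ) (h0 : 4 ≤ Nat.card G) {J : Type} [Fintype J] [DecidableEq J]
    (Φ : J → Finset G) (hΦ : ∀ j, IsCMType c (Φ j))
    (hg : (∑ j, Nat.card G / (2 * Nat.card (rstab (Φ j)))) ≤ p) :
    ∃ V : Vocab G c, V.BMM2016_Cor2 p k ∧ (∀ j, V.Meng2019_Lemma4_1_codim j) ∧ V.DR2015_Lemma3_5 ∧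
      (∀ q, V.Liu2021_Cor4_20 q) ∧ V.Liu2021_Def4_5_Shimura8_3 ∧ V.RouteC_LemmaR ∧
      V.IsogFactorMult_of_isog_pow ∧ ¬ V.RouteC_R5 p ∧
      ∀ {ι : Type} [Fintype ι] (T : ι → Finset G), ¬ V.WeilAlgebraic T := by
  refine ⟨mk (fun _ _ => False) (fun _ _ => True) (fun _ _ => False) (CMChar c) (fun μ : CMChar c => μ.1)
    (fun μ : CMChar c => μ.2) (fun _ _ => True) (fun _ _ _ => True) (fun _ => False) (fun _ => 0),
    ?_, ?_, ?_, ?_, ?_, ?_, ?_, ?_, ?_⟩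
  · intro _ _ S hS; exact hS.elim
  · intro j X Y _ h; exact h.elim
  · intro Φ' hΦ'; exact ⟨toChar hΦ', rfl⟩
  · intro q _ μ m; exact ⟨(), trivial⟩
  · intro μ; exact ⟨1, le_rfl, trivial⟩
  · intro ι J' _ _ _ _ Φ' cls tw _ _ _ _ h; exact h.elim
  · intro X Y Z d m _ _ h; exact h
  · intro h
    obtain ⟨S, hS, _⟩ := h h0 Φ hΦ (fun j m => ⟨(), trivial⟩) hg
    exact hS
  · intro ι _ T h; exact h

/-- **Lemma R is load-bearing**: HC holds everywhere, but no Weil line is algebraic — the face's own data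
(its `SumTwo` corners with distinct `(cls, tw)` and distinct corners) exhibit the failure of Lemma R. -/
theorem lemmaR_independent (hc : IsComplexConj c) (p k : ℕ) {ι J : Type} [Fintype ι] [DecidableEq ι]
    [Fintype J] [DecidableEq J] (Φ : J → Finset G) (cls : ι → J) (tw : ι → G)
    (hΦ : ∀ j, IsCMType c (Φ j)) (hsum : SumTwo (corner Φ cls tw))
    (hinj : Function.Injective fun i => (cls i, tw i))
    (hcinj : Function.Injective (corner Φ cls tw)) :
    ∃ V : Vocab G c, V.BMM2016_Cor2 p k ∧ (∀ j, V.Meng2019_Lemma4_1_codim j) ∧ V.DR2015_Lemma3_5 ∧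
      (∀ q, V.Liu2021_Cor4_20 q) ∧ V.Liu2021_Def4_5_Shimura8_3 ∧ (∀ q, V.RouteC_R5 q) ∧
      V.IsogFactorMult_of_isog_pow ∧ ¬ V.RouteC_LemmaR ∧
      ∀ {ι' : Type} [Fintype ι'] (T : ι' → Finset G), ¬ V.WeilAlgebraic T := by
  refine ⟨mk (fun _ _ => True) (fun _ _ => True) (fun _ _ => True) (CMChar c) (fun μ : CMChar c => μ.1)
    (fun μ : CMChar c => μ.2) (fun _ _ => True) (fun _ _ _ => True) (fun _ => False) (fun _ => 0),
    ?_, ?_, ?_, ?_, ?_, ?_, ?_, ?_, ?_⟩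
  · intro _ _ S _; trivial
  · intro j X Y _ _; trivial
  · intro Φ' hΦ'; exact ⟨toChar hΦ', rfl⟩
  · intro q _ μ m; exact ⟨(), trivial⟩
  · intro μ; exact ⟨1, le_rfl, trivial⟩
  · intro q _ J' _ _ Φ' _ _ _; exact ⟨(0 : ℕ), trivial, trivial⟩
  · intro X Y Z d m _ _ h; exact h
  · intro h
    have hρ : ∀ s : G, Set.InjOn (cosetMap Φ) (reducedSet cls tw s) :=
      injOn_cosetMap_reducedSet_of_injective Φ cls tw hcinj
    exact h Φ cls tw hΦ hinj hρ
      (fun s => isHodgeSetOn_cosetMap_reducedSet hc Φ cls tw hinj hsum s (hρ s)) trivial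
  · intro ι' _ T h; exact h

/-- **The isogeny bookkeeping is load-bearing**: `A_μ` (`7`) is isogenous to a power of the simple factor
(`3`) and is an Albanese factor, but the simple factor is not. -/
theorem isog_independent (p k : ℕ) :
    ∃ V : Vocab G c, V.BMM2016_Cor2 p k ∧ (∀ j, V.Meng2019_Lemma4_1_codim j) ∧ V.DR2015_Lemma3_5 ∧
      (∀ q, V.Liu2021_Cor4_20 q) ∧ V.Liu2021_Def4_5_Shimura8_3 ∧ (∀ q, V.RouteC_R5 q) ∧
      V.RouteC_LemmaR ∧ ¬ V.IsogFactorMult_of_isog_pow ∧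
      ∀ {ι : Type} [Fintype ι] [Nonempty ι] (T : ι → Finset G), ¬ V.WeilAlgebraic T := by
  refine ⟨mk (fun S _ => S = 0) (fun _ Y => Y = 0) (fun S _ => S = 0) (CMChar c) (fun μ : CMChar c => μ.1)
    (fun μ : CMChar c => μ.2) (fun _ _ => True) (fun _ Y _ => Y = 7) (fun {ι} _ _ => IsEmpty ι)
    (fun {J} _ _ _ => Fintype.card J),
    ?_, ?_, ?_, ?_, ?_, ?_, ?_, ?_, ?_⟩
  · intro _ _ S hS; exact hS
  · intro j X Y hXY _; exact hXY
  · intro Φ hΦ; exact ⟨toChar hΦ, rfl⟩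
  · intro q _ μ m; exact ⟨(), rfl⟩
  · intro μ; exact ⟨1, le_rfl, trivial⟩
  · intro q _ J _ _ Φ _ halb _
    by_cases hJ : Nonempty J
    · obtain ⟨k₀⟩ := hJ
      obtain ⟨_, h⟩ := halb k₀ 0
      exact absurd h (show ¬ ((3 : ℕ) = 7) by norm_num)
    · refine ⟨(0 : ℕ), rfl, ?_⟩
      show Fintype.card J = 0
      rw [Fintype.card_eq_zero_iff]; exact not_nonempty_iff.1 hJ
  · intro ι J _ _ _ _ Φ cls tw _ _ _ _ h
    show IsEmpty ι
    have hJ : IsEmpty J := by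
      rw [← Fintype.card_eq_zero_iff]; exact h
    exact Function.isEmpty cls
  · intro h
    have := h (0 : ℕ) (7 : ℕ) (3 : ℕ) 1 0 le_rfl trivial rfl
    exact absurd this (show ¬ ((3 : ℕ) = 7) by norm_num)
  · intro ι _ _ T h; exact h.false (Classical.arbitrary ι)

end LoadBearing

end HodgeRepro.RouteC
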